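import Summits.FinalStateConjecture.FinalStateConjecture.Theorems.ClusterCompletenessOmegaLimitMultiKerrTranslateCompactness
import Literature.Geometry.Lorentzian.KerrConvergence
import HarnessLib

/-!
# Route ClusterCompleteness · crux `OmegaLimitMultiKerr` — late-time `Cᵏ_loc` ω-limits of a field
# that is `C^{k+1}`-bounded on the truncated late regions of a background with a time translation

Structure lemma for the crux stmt-FinalStateConjecture-14664 (`ClusterCompleteness.OmegaLimitMultiKerr`,
rank 9), line `Sketch`, lead gen 3 — the form of ω-limit compactness that the crux's HOLE CHARTS consume.
A hole chart `Ψᵢ` of the recur-disjunct `Recurs k 𝒟` lives on a boosted Kerr background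
`B = boostedKerrBackground Λ c M a`, whose domain, radius function and reference metric are invariant
under the Killing translation `x ↦ x + s • Λ∂₀` while the chart time `t*` is shifted by `s`
(`KerrSchildChart.time_add_smul / radius_add_smul / boostedKerrBilin_add_smul`). "Tameness" of such a
chart is an ALL-TIME bound on the `C^{k+1}` size of the deviation `Ψᵢ^* g − g_{M,a}` on every truncated
late region `{t* > τ₀, r ≤ R}` (bound depending on `R`). This file proves, abstractly over any
`ModelBackground` with such a translation vector `e`:

**Theorem (`exists_omegaLimit_translate_of_bounded_truncLateRegion`).** If `h : E4 → W` is `C^{k+1}`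
on the (open, `e`-invariant) domain and its derivatives of order `≤ k + 1` are bounded on each
truncated late region `{t > τ₀, r ≤ R}`, then for EVERY sequence of times `T n → +∞` a subsequence of
the translates `h (· + T (φ n) • e)` converges in `Cᵏ` on every compact subset of the domain to a `Cᵏ`
field `g` (an ω-limit of `h` along `T`).

Proof: a compact `K` of the domain has bounded time and radius (continuity), so its translates by
`T n • e` lie in one truncated late region for all large `n`, where the all-time bound applies; then
`exists_strictMono_tendsto_supCkENorm_translate_sub` (the `Cᵏ` Arzelà–Ascoli theorem on translates,
landed in `…TranslateCompactness`). This is step (i) "ω-limits exist" of the LaSalle reading of the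
crux (idea card `lasalle-lands-on-liminf`; Hale 1980, Ch. I, §8; Petersen 2006, Ch. 10, §3.1), with no
claim yet about WHAT the limits are.
-/

-- every `Summit.FinalStateConjecture.FinalStateConjecture.…` name repeats the summit = sub-problem segment (D-0017 layout)
set_option linter.dupNamespace false

noncomputable section

open Set Filter Topology Function TopologicalSpace
open scoped ContDiff Topology ENNReal

namespace Summit.FinalStateConjecture.FinalStateConjecture.Theorems.ClusterCompleteness

open Literature.Geometry.Lorentzian

/-- **Late-time `Cᵏ_loc` ω-limits along every `T n → ∞` for a field that is `C^{k+1}`-bounded on the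
truncated late regions of a background with a time-translation vector `e`.** Hypotheses: the domain
of `B` is invariant under `x ↦ x + s • e`, the time function is shifted by `s` and the radius function
is invariant (e.g. `e = Λ∂₀` for `boostedKerrBackground Λ c M a`), both are continuous; `h` is
`C^{k+1}` on the domain with, for every `R`, a bound on all derivatives of order `≤ k + 1` over
`{t > τ₀, r ≤ R}`. Conclusion: along a subsequence of ANY `T n → +∞` the translates converge in `Cᵏ` on
compacts of the domain to a `Cᵏ` field (Hale 1980, Ch. I, §8: bounded orbits have nonempty ω-limit
sets; the compactness is the `Cᵏ` Arzelà–Ascoli theorem, Petersen 2006, Ch. 10, §3.1).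
[cite: Petersen2006, Ch. 10 §3.1] -/
theorem exists_omegaLimit_translate_of_bounded_truncLateRegion :
    ∀ {W : Type*} [NormedAddCommGroup W] [NormedSpace ℝ W] [FiniteDimensional ℝ W]
      (B : ModelBackground) (e : E4),
      (∀ x ∈ (B.domain : Set E4), ∀ s : ℝ, x + s • e ∈ (B.domain : Set E4)) →
      (∀ (x : E4) (s : ℝ), B.time (x + s • e) = B.time x + s) →
      (∀ (x : E4) (s : ℝ), B.radius (x + s • e) = B.radius x) →
      Continuous B.time → Continuous B.radius →
      ∀ {k : ℕ} {h : E4 → W}, ContDiffOn ℝ (k + 1) h (B.domain : Set E4) →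
      ∀ {τ₀ : ℝ}, (∀ R : ℝ, ∃ C : ℝ, ∀ i, i ≤ k + 1 →
        ∀ x ∈ Subtype.val '' B.truncLateRegion τ₀ R, ‖iteratedFDeriv ℝ i h x‖ ≤ C) →
      ∀ {T : ℕ → ℝ}, Tendsto T atTop atTop →
      ∃ (g : E4 → W) (φ : ℕ → ℕ), StrictMono φ ∧ ContDiffOn ℝ k g (B.domain : Set E4) ∧
        ∀ K ⊆ (B.domain : Set E4), IsCompact K →
          Tendsto (fun n ↦ supCkENorm K k (fun x ↦ h (x + T (φ n) • e) - g x)) atTop (𝓝 0) := by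
  intro W _ _ _ B e hdom htime hrad htc hrc k h hh τ₀ hb T hT
  -- nonnegative times agreeing with `T` eventually
  set T' : ℕ → ℝ := fun n ↦ max (T n) 0 with hT'def
  have hT'0 : ∀ n, 0 ≤ T' n := fun n ↦ le_max_right _ _
  have hT' : Tendsto T' atTop atTop := tendsto_atTop_mono (fun n ↦ le_max_left _ _) hT
  have hTT' : ∀ᶠ n in atTop, T' n = T n := by
    filter_upwards [hT.eventually_ge_atTop 0] with n hn
    exact max_eq_left hn
  have hO : IsOpen (B.domain : Set E4) := B.domain.isOpen
  have hOw : ∀ x ∈ (B.domain : Set E4), ∀ s : ℝ, 0 ≤ s → x + s • e ∈ (B.domain : Set E4) :=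
    fun x hx s _ ↦ hdom x hx s
  -- eventual common bounds on the translates of a compact set
  have hb' : ∀ K ⊆ (B.domain : Set E4), IsCompact K → ∃ Λ : ℝ, ∀ᶠ n in atTop,
      ∀ i, i ≤ k + 1 → ∀ z ∈ K, ‖iteratedFDeriv ℝ i h (z + T' n • e)‖ ≤ Λ := by
    intro K hKO hK
    obtain ⟨t₀, ht₀⟩ := hK.bddBelow_image htc.continuousOn
    obtain ⟨R₀, hR₀⟩ := hK.bddAbove_image hrc.continuousOn
    obtain ⟨C, hC⟩ := hb R₀
    refine ⟨C, ?_⟩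
    filter_upwards [hT'.eventually_gt_atTop (τ₀ - t₀)] with n hn i hi z hz
    refine hC i hi _ ⟨⟨z + T' n • e, hdom z (hKO hz) _⟩, ⟨?_, ?_⟩, rfl⟩
    · have h1 : t₀ ≤ B.time z := ht₀ (mem_image_of_mem _ hz)
      show τ₀ < B.time (z + T' n • e)
      rw [htime]
      linarith
    · have h2 : B.radius z ≤ R₀ := hR₀ (mem_image_of_mem _ hz)
      show B.radius (z + T' n • e) ≤ R₀
      rwa [hrad]
  obtain ⟨g, φ, hφ, hg, hlim⟩ :=
    exists_strictMono_tendsto_supCkENorm_translate_sub hO hOw hh hT'0 hb'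
  refine ⟨g, φ, hφ, hg, fun K hKO hK ↦ ?_⟩
  have hev : ∀ᶠ n in atTop, T' (φ n) = T (φ n) := hφ.tendsto_atTop.eventually hTT'
  refine (hlim K hKO hK).congr' ?_
  filter_upwards [hev] with n hn
  rw [hn]

/-! ### The dictionary: recurrence along `T` versus flatness of the ω-limits along `T` -/

/-- **Recurrence at every radius forces every ω-limit to be flat to order `k` on the time-zero slab.**
In the setting of `exists_omegaLimit_translate_of_bounded_truncLateRegion`: if along the times `T n`
the translates `h (· + T n • e)` converge in `Cᵏ` on compacts of the domain to `g`, and their `Cᵏ`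
sup norms over EVERY time-zero truncated slab `{t = 0, r ≤ R'}` tend to `0` (for the deviation of a
hole chart this is the crux's recurrence at hole `i` along `T n`, read through the translation
identity `truncDeviationCk … R' τ = supCkENorm {t = 0, r ≤ R'} (translate by τ)`), then all
derivatives of `g` of order `≤ k` vanish on the slab `{t = 0}`: the ω-limit chart geometry agrees with
the reference background to order `k` there (LaSalle reading of the recur-disjunct: the reference
configuration is an ω-limit POINT; Hale 1980, Ch. I, §8). [cite: Hale1980, Ch. I §8] -/
theorem iteratedFDeriv_omegaLimit_eq_zero_of_tendsto_supCkENorm_truncTimeSlab :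
    ∀ {W : Type*} [NormedAddCommGroup W] [NormedSpace ℝ W]
      (B : ModelBackground) (e : E4),
      (∀ x ∈ (B.domain : Set E4), ∀ s : ℝ, x + s • e ∈ (B.domain : Set E4)) →
      ∀ {k : ℕ} {h : E4 → W}, ContDiffOn ℝ (k + 1) h (B.domain : Set E4) →
      ∀ {g : E4 → W}, ContDiffOn ℝ k g (B.domain : Set E4) →
      ∀ {T : ℕ → ℝ},
      (∀ K ⊆ (B.domain : Set E4), IsCompact K →
        Tendsto (fun n ↦ supCkENorm K k (fun x ↦ h (x + T n • e) - g x)) atTop (𝓝 0)) →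
      (∀ R' : ℝ, Tendsto (fun n ↦ supCkENorm (Subtype.val '' B.truncTimeSlab R' 0) k
        (fun x ↦ h (x + T n • e))) atTop (𝓝 0)) →
      ∀ x ∈ Subtype.val '' B.timeSlab 0, ∀ m, m ≤ k → iteratedFDeriv ℝ m g x = 0 := by
  intro W _ _ B e hdom k h hh g hg T hlim hrec x hx m hm
  obtain ⟨y, hy, rfl⟩ := hx
  have hO : IsOpen (B.domain : Set E4) := B.domain.isOpen
  have hyO : (y : E4) ∈ (B.domain : Set E4) := y.2
  -- the two vanishing quantities at the point `y`
  have hyTS : (y : E4) ∈ Subtype.val '' B.truncTimeSlab (B.radius y.1) 0 :=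
    ⟨y, ⟨hy, le_rfl⟩, rfl⟩
  have hK : IsCompact ({(y : E4)} : Set E4) := isCompact_singleton
  have hKO : ({(y : E4)} : Set E4) ⊆ (B.domain : Set E4) := singleton_subset_iff.2 hyO
  have h1 := hlim {(y : E4)} hKO hK
  have h2 := hrec (B.radius y.1)
  -- smoothness at `y` of the translates and of the limit
  have hgn : ContDiffAt ℝ m g y :=
    (hg.of_le (by exact_mod_cast hm)).contDiffAt (hO.mem_nhds hyO)
  have hhn : ∀ n, ContDiffAt ℝ m (fun x ↦ h (x + T n • e)) y := by
    intro n
    have hmem : (y : E4) + T n • e ∈ (B.domain : Set E4) := hdom _ hyO _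
    have h' : ContDiffAt ℝ m h ((y : E4) + T n • e) :=
      (hh.of_le (by exact_mod_cast Nat.le_succ_of_le hm)).contDiffAt (hO.mem_nhds hmem)
    exact h'.comp (y : E4) (contDiffAt_id.add contDiffAt_const)
  -- pointwise bound `‖Dᵐ g (y)‖ ≤ aₙ + bₙ` with `aₙ, bₙ → 0`
  have hle : ∀ n, ‖iteratedFDeriv ℝ m g y‖ₑ ≤
      supCkENorm {(y : E4)} k (fun x ↦ h (x + T n • e) - g x) +
        supCkENorm (Subtype.val '' B.truncTimeSlab (B.radius y.1) 0) k
          (fun x ↦ h (x + T n • e)) := by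
    intro n
    have hsub : iteratedFDeriv ℝ m (fun x ↦ h (x + T n • e) - g x) y =
        iteratedFDeriv ℝ m (fun x ↦ h (x + T n • e)) y - iteratedFDeriv ℝ m g y :=
      iteratedFDeriv_sub_apply (hhn n) hgn
    have heq : iteratedFDeriv ℝ m g y = iteratedFDeriv ℝ m (fun x ↦ h (x + T n • e)) y -
        iteratedFDeriv ℝ m (fun x ↦ h (x + T n • e) - g x) y := by
      rw [hsub, sub_sub_cancel]
    calc ‖iteratedFDeriv ℝ m g y‖ₑ
        ≤ ‖iteratedFDeriv ℝ m (fun x ↦ h (x + T n • e)) y‖ₑ +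
            ‖iteratedFDeriv ℝ m (fun x ↦ h (x + T n • e) - g x) y‖ₑ := by
          rw [heq]; exact enorm_sub_le
      _ ≤ supCkENorm (Subtype.val '' B.truncTimeSlab (B.radius y.1) 0) k
            (fun x ↦ h (x + T n • e)) +
            supCkENorm {(y : E4)} k (fun x ↦ h (x + T n • e) - g x) :=
          add_le_add (enorm_iteratedFDeriv_le_supCkENorm hm hyTS _)
            (enorm_iteratedFDeriv_le_supCkENorm hm (mem_singleton _) _)
      _ = _ := add_comm _ _
  have hlim0 : Tendsto (fun n ↦ supCkENorm {(y : E4)} k (fun x ↦ h (x + T n • e) - g x) +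
      supCkENorm (Subtype.val '' B.truncTimeSlab (B.radius y.1) 0) k
        (fun x ↦ h (x + T n • e))) atTop (𝓝 0) := by
    simpa using h1.add h2
  have hzero : ‖iteratedFDeriv ℝ m g y‖ₑ ≤ 0 := ge_of_tendsto' hlim0 hle
  exact enorm_eq_zero.1 (le_zero_iff.mp hzero)

/-- **Conversely: flatness of the ω-limit on a compact part of the slab gives `Cᵏ` recurrence there.**
If the translates `h (· + T n • e)` converge in `Cᵏ` on the set `K ⊆ O` to `g` and all derivatives
of `g` of order `≤ k` vanish on `K`, then the `Cᵏ` sup norms of the translates over `K` tend to `0`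
along `T n` (pure bookkeeping: the two sup norms agree term by term). Together with the previous
theorem: along a sequence of times, recurrence on a compact near-zone set is EQUIVALENT to flatness
there of the ω-limit it defines (Hale 1980, Ch. I, §8). [cite: Hale1980, Ch. I §8] -/
theorem tendsto_supCkENorm_translate_of_iteratedFDeriv_omegaLimit_eq_zero :
    ∀ {W : Type*} [NormedAddCommGroup W] [NormedSpace ℝ W] {O : Set E4}, IsOpen O →
      ∀ (e : E4), (∀ x ∈ O, ∀ s : ℝ, x + s • e ∈ O) →
      ∀ {k : ℕ} {h : E4 → W}, ContDiffOn ℝ (k + 1) h O →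
      ∀ {g : E4 → W}, ContDiffOn ℝ k g O →
      ∀ {T : ℕ → ℝ} {K : Set E4}, K ⊆ O →
      Tendsto (fun n ↦ supCkENorm K k (fun x ↦ h (x + T n • e) - g x)) atTop (𝓝 0) →
      (∀ x ∈ K, ∀ m, m ≤ k → iteratedFDeriv ℝ m g x = 0) →
      Tendsto (fun n ↦ supCkENorm K k (fun x ↦ h (x + T n • e))) atTop (𝓝 0) := by
  intro W _ _ O hO e hOe k h hh g hg T K hKO hlim hjet
  have heq : ∀ n, supCkENorm K k (fun x ↦ h (x + T n • e)) =
      supCkENorm K k (fun x ↦ h (x + T n • e) - g x) := by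
    intro n
    unfold supCkENorm
    refine iSup_congr fun m ↦ iSup_congr fun hm ↦ iSup_congr fun x ↦ iSup_congr fun hx ↦ ?_
    have hgn : ContDiffAt ℝ m g x :=
      (hg.of_le (by exact_mod_cast hm)).contDiffAt (hO.mem_nhds (hKO hx))
    have hhn : ContDiffAt ℝ m (fun x ↦ h (x + T n • e)) x := by
      have hmem : x + T n • e ∈ O := hOe _ (hKO hx) _
      have h' : ContDiffAt ℝ m h (x + T n • e) :=
        (hh.of_le (by exact_mod_cast Nat.le_succ_of_le hm)).contDiffAt (hO.mem_nhds hmem)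
      exact h'.comp x (contDiffAt_id.add contDiffAt_const)
    have hsub : iteratedFDeriv ℝ m (fun x ↦ h (x + T n • e) - g x) x =
        iteratedFDeriv ℝ m (fun x ↦ h (x + T n • e)) x - iteratedFDeriv ℝ m g x :=
      iteratedFDeriv_sub_apply hhn hgn
    rw [hsub, hjet x hx m hm, sub_zero]
  simp_rw [heq]
  exact hlim

end Summit.FinalStateConjecture.FinalStateConjecture.Theorems.ClusterCompleteness

end
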